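import Summits.NavierStokesRegularity.NavierStokesRegularity.Theorems.EpisodeBaseT.Negative.MirrorInvariantPusherNoAnchor
import HarnessLib

/-!
# The anchor number is QUADRATIC in the device: sign-reversed devices anchor alike, and `z ↦ −z`-ODD far pushers
# (e.g. the ANTISYMMETRIC ring pair) have anchor number ZERO (Negative lane, `EpisodeBaseT`, line «doormirror», stub D2a)

Cell `ns-blowup`, seat `ns-blowup-refuter4` (g12; D-0074 GROUP C «BRIDGE SUPPORT», Negative lane (α)). Fifth file of the
mirror series (p567521 `RingPusherMirrorAnchorSign`, p569185 `SterileCarrierMirrorNotLevelZero`, p572223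
`MirrorInvariantPusherNoAnchor`, p572865 `MirrorPairAtMostOneAnchors`).

The anchor integrand `x ↦ D³Γ(0 − x)(P x, P x, c e₃)` of p567521 is a QUADRATIC form in the device value `P x`:

* `anchorIntegrand_smul` — `anchorIntegrand (μ • P) c x = μ² · anchorIntegrand P c x` for EVERY `μ`, `P`, `c`, `x` (no
  differentiability needed: scalars pass through `fderiv` over a field, `fderiv_const_smul_field`); hence
  `anchorIntegrand_neg` (`−P` and `P` have the same integrand) and `integral_anchorIntegrand_smul`.
* `strictAnchor_add_neg_iff` — for an even admissible core `U₁` (`tsupport U₁ ⊆ B(0, r₁)`, `U₁ 0 = c e₃`) and ANY admissible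
  far device `P` (`tsupport P ⊆ {‖x‖ ≥ r₁}`): `U₁ − P` strictly anchors at `0` IFF `U₁ + P` does — REVERSING THE FLOW
  DIRECTION of a sterile pusher never changes the anchor verdict; only its geometry and its side do (p569185, p572865).
* `integral_anchorIntegrand_eq_zero_of_mirror_odd` — if `P` is MIRROR-ODD (`M (P (M y)) = −P y`, `P 0 = 0`) its anchor
  integral is `0` (p567521: the mirror flips the sign; this file: negation does not); so
  `not_strictAnchor_add_of_mirror_odd` and `not_levelZeroDataAt_tinyProfileAt_add_of_mirror_odd` — exactly as for
  mirror-INVARIANT devices (p572223): an even core plus a mirror-odd far device never strictly anchors, and the blob of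
  record plus such a device is never level-0 data.
* generic (anti)symmetrisation: for ANY field `A`, `A + A♭` is mirror-invariant and `A − A♭` is mirror-odd
  (`A♭ y = M (A (M y))`); instance: the ANTISYMMETRIC RING PAIR `μ • (ringPusher δ − mirrorRingPusher δ)` (ring above
  pushing one way, its mirror image below pushing the other way; sterile, smooth, divergence free, compactly supported)
  never fills level 0 with the blob of record, for every `μ` and every `0 < δ ≤ 1/4`
  (`not_levelZeroDataAt_tinyProfileAt_add_smul_ringAntiPair`).

Reading for the stub: within the two-sided family `μ₁ • ringPusher δ + μ₂ • mirrorRingPusher δ` BOTH diagonals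
`|μ₁| = |μ₂|` are sterile for anchoring, whatever the signs; the anchor number sees the device only through the even
quadratic form above.

LABEL: kernel analysis (theorems only). WHAT THIS IS NOT: not Navier–Stokes evidence; not a refutation of D2a (existential,
and a theorem by name since p569312) or of any route item; no flow, stage, schedule or certificate; sorry-free, std axioms.
bears_on: LADDER-NS N1 (route-NavierStokesRegularity-PalasekTowerBreakdown), item 20303, stub D2a.

References: A. J. Majda, A. L. Bertozzi (CUP 2002) §1.8 Prop. 1.16 [cite: MajdaBertozziCUP2002, §1.8 Prop. 1.16].
-/

noncomputable section

open Literature.Analysis.FluidPDE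
open Summit.NavierStokesRegularity.FluidComputer.PalasekTowerClayBridge
open Summit.NavierStokesRegularity.FluidComputer.PalasekTowerClayBridge.TinyBlob
open Summit.NavierStokesRegularity.FluidComputer.PalasekTowerClayBridge.Germ
open Summit.NavierStokesRegularity.EpisodeBaseTRingPusherMirrorAnchorSign
open Summit.NavierStokesRegularity.EpisodeBaseTMirrorInvariantPusherNoAnchor
open MeasureTheory InnerProductSpace Metric Set
open scoped RealInnerProductSpace ContDiff Laplacian

-- nested operator types `ℝ³ →L[ℝ] ℝ³ →L[ℝ] ℝ`
set_option maxSynthPendingDepth 3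

namespace Summit.NavierStokesRegularity.EpisodeBaseTMirrorOddPusherNoAnchor

/-! ## §1 The anchor integrand is a quadratic form in the device -/

/-- **Quadratic homogeneity**: `anchorIntegrand (μ • P) c x = μ² · anchorIntegrand P c x` — for every `μ`, with no
differentiability hypothesis (over a field a constant factor passes through `fderiv` unconditionally). [folklore] -/
theorem anchorIntegrand_smul (P : EuclideanSpace ℝ (Fin 3) → EuclideanSpace ℝ (Fin 3)) (μ c : ℝ)
    (x : EuclideanSpace ℝ (Fin 3)) : anchorIntegrand (μ • P) c x = μ ^ 2 * anchorIntegrand P c x := by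
  unfold anchorIntegrand
  have h1 : (fun w' => fderiv ℝ newtonKernel w' ((μ • P) x)) = μ • fun w' => fderiv ℝ newtonKernel w' (P x) := by
    funext w'
    simp only [Pi.smul_apply, map_smul, smul_eq_mul]
  have h2 : (fun w => fderiv ℝ (fun w' => fderiv ℝ newtonKernel w' ((μ • P) x)) w ((μ • P) x)) =
      (μ * μ) • fun w => fderiv ℝ (fun w' => fderiv ℝ newtonKernel w' (P x)) w (P x) := by
    funext w
    rw [h1, fderiv_const_smul_field]
    simp only [_root_.FunLike.coe_smul, Pi.smul_apply, map_smul, smul_eq_mul]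
    ring
  rw [h2, fderiv_const_smul_field]
  simp only [_root_.FunLike.coe_smul, Pi.smul_apply, smul_eq_mul]
  ring

/-- **Sign reversal is invisible**: `anchorIntegrand (−P) c x = anchorIntegrand P c x`. [folklore] -/
theorem anchorIntegrand_neg (P : EuclideanSpace ℝ (Fin 3) → EuclideanSpace ℝ (Fin 3)) (c : ℝ)
    (x : EuclideanSpace ℝ (Fin 3)) : anchorIntegrand (-P) c x = anchorIntegrand P c x := by
  have h := anchorIntegrand_smul P (-1) c x
  rw [neg_one_smul] at h
  rw [h]
  ring

/-- `∫ anchorIntegrand (μ • P) c = μ² · ∫ anchorIntegrand P c`. [folklore] -/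
theorem integral_anchorIntegrand_smul (P : EuclideanSpace ℝ (Fin 3) → EuclideanSpace ℝ (Fin 3)) (μ c : ℝ) :
    ∫ x, anchorIntegrand (μ • P) c x = μ ^ 2 * ∫ x, anchorIntegrand P c x := by
  simp only [anchorIntegrand_smul]
  exact integral_const_mul _ _

/-- `∫ anchorIntegrand (−P) c = ∫ anchorIntegrand P c`. [folklore] -/
theorem integral_anchorIntegrand_neg (P : EuclideanSpace ℝ (Fin 3) → EuclideanSpace ℝ (Fin 3)) (c : ℝ) :
    ∫ x, anchorIntegrand (-P) c x = ∫ x, anchorIntegrand P c x := by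
  simp only [anchorIntegrand_neg]

/-- The topological support of `−P` lies as far out as that of `P`. [folklore] -/
theorem far_of_mem_tsupport_neg {P : EuclideanSpace ℝ (Fin 3) → EuclideanSpace ℝ (Fin 3)} {r₁ : ℝ}
    (hfarP : ∀ x ∈ tsupport P, r₁ ≤ ‖x‖) : ∀ x ∈ tsupport (-P), r₁ ≤ ‖x‖ := fun x hx => by
  rw [tsupport_neg] at hx
  exact hfarP x hx

/-- `−P` is divergence free when `P` is (and `P` is differentiable). [folklore] -/
theorem isDivFree_neg {P : EuclideanSpace ℝ (Fin 3) → EuclideanSpace ℝ (Fin 3)} (hP : Differentiable ℝ P)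
    (hdiv : VectorCalculus.IsDivFree P) : VectorCalculus.IsDivFree (-P) := by
  have h := VectorCalculus.IsDivFree.const_smul hP hdiv (-1)
  have hf : (fun y => (-1 : ℝ) • P y) = -P := funext fun y => by simp
  intro x
  have hx := h x
  rw [hf] at hx
  exact hx

/-- **REVERSING THE DEVICE NEVER CHANGES THE ANCHOR VERDICT.** `U₁ ∈ C_c^∞` divergence free, even about `0`,
`tsupport U₁ ⊆ B(0, r₁)`, `U₁ 0 = c e₃`; `P ∈ C_c^∞` divergence free with `tsupport P ⊆ {‖x‖ ≥ r₁}`. Then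
`U₁ − P` strictly anchors at `0` iff `U₁ + P` does (both tests read `−ν⟪U₁ 0, ΔU₁ 0⟫ < ∫ anchorIntegrand (±P) c`, and the
two integrands coincide). [cite: MajdaBertozziCUP2002, §1.8 Prop. 1.16] -/
theorem strictAnchor_add_neg_iff {ν : ℝ}
    {U₁ P : EuclideanSpace ℝ (Fin 3) → EuclideanSpace ℝ (Fin 3)} (h₁ : ContDiff ℝ ∞ U₁) (h₁c : HasCompactSupport U₁)
    (hdiv₁ : VectorCalculus.IsDivFree U₁) (he : IsEvenAbout 0 U₁) {r₁ : ℝ} (hr₁ : 0 < r₁)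
    (hsupp : tsupport U₁ ⊆ ball (0 : EuclideanSpace ℝ (Fin 3)) r₁)
    (h₂ : ContDiff ℝ ∞ P) (h₂c : HasCompactSupport P) (hdiv₂ : VectorCalculus.IsDivFree P)
    (hfarP : ∀ x ∈ tsupport P, r₁ ≤ ‖x‖) {c : ℝ} (hU0 : U₁ 0 = c • e₃) :
    0 < ⟪(U₁ + -P) 0, accel ν (U₁ + -P) 0⟫ ↔ 0 < ⟪(U₁ + P) 0, accel ν (U₁ + P) 0⟫ := by
  have hdisj : ∀ {Q : EuclideanSpace ℝ (Fin 3) → EuclideanSpace ℝ (Fin 3)}, (∀ x ∈ tsupport Q, r₁ ≤ ‖x‖) →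
      Disjoint (tsupport U₁) (tsupport Q) := fun hfar =>
    disjoint_left.2 fun x hx₁ hx₂ => (not_le.2 (mem_ball_zero_iff.1 (hsupp hx₁))) (hfar x hx₂)
  have hfar' : ∀ {Q : EuclideanSpace ℝ (Fin 3) → EuclideanSpace ℝ (Fin 3)}, (∀ x ∈ tsupport Q, r₁ ≤ ‖x‖) →
      ∀ x ∈ tsupport Q, r₁ / 2 < ‖(0 : EuclideanSpace ℝ (Fin 3)) - x‖ := fun hfar x hx => by
    rw [zero_sub, norm_neg]
    linarith [hfar x hx]
  have hr2 : (0 : ℝ) < r₁ / 2 := by linarith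
  have hnegfar := far_of_mem_tsupport_neg hfarP
  rw [anchor_test_iff_fderiv3 (ν := ν) (U₂ := -P) h₁ h₁c hdiv₁ he h₂.neg h₂c.neg
      (isDivFree_neg (h₂.differentiable (by simp)) hdiv₂) (hdisj hnegfar) hr2 (hfar' hnegfar),
    anchor_test_iff_fderiv3 (ν := ν) h₁ h₁c hdiv₁ he h₂ h₂c hdiv₂ (hdisj hfarP) hr2 (hfar' hfarP), hU0]
  show _ < ∫ x, anchorIntegrand (-P) c x ↔ _ < ∫ x, anchorIntegrand P c x
  rw [integral_anchorIntegrand_neg]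

/-! ## §2 Mirror-odd devices have anchor number zero -/

/-- **Mirror-odd ⇒ anchor integral `0`**: if `M (P (M y)) = −P y` for all `y` and `P 0 = 0`, then
`∫ D³Γ(0 − x)(P x, P x, c e₃) dx = 0` for every `c` (p567521: it equals MINUS the integral of `−P`, which is the
integral of `P`). [cite: MajdaBertozziCUP2002, §1.8 Prop. 1.16] -/
theorem integral_anchorIntegrand_eq_zero_of_mirror_odd (P : EuclideanSpace ℝ (Fin 3) → EuclideanSpace ℝ (Fin 3))
    (hP : ∀ y, mirrorZ (P (mirrorZ y)) = -P y) (hP0 : P 0 = 0) (c : ℝ) :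
    ∫ x, anchorIntegrand P c x = 0 := by
  have h := integral_anchorIntegrand_mirror P hP0 c
  have hfun : (fun y => mirrorZ (P (mirrorZ y))) = -P := funext hP
  rw [hfun, integral_anchorIntegrand_neg] at h
  linarith

/-- **The strict anchor FAILS for an even core plus ANY mirror-odd far pusher.** Hypotheses as in p572223's
`not_strictAnchor_add_of_mirror_invariant`, with `P` mirror-ODD instead. [cite: MajdaBertozziCUP2002, §1.8 Prop. 1.16] -/
theorem not_strictAnchor_add_of_mirror_odd {ν : ℝ}
    {U₁ P : EuclideanSpace ℝ (Fin 3) → EuclideanSpace ℝ (Fin 3)} (h₁ : ContDiff ℝ ∞ U₁) (h₁c : HasCompactSupport U₁)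
    (hdiv₁ : VectorCalculus.IsDivFree U₁) (he : IsEvenAbout 0 U₁) {r₁ : ℝ} (hr₁ : 0 < r₁)
    (hsupp : tsupport U₁ ⊆ ball (0 : EuclideanSpace ℝ (Fin 3)) r₁)
    (h₂ : ContDiff ℝ ∞ P) (h₂c : HasCompactSupport P) (hdiv₂ : VectorCalculus.IsDivFree P)
    (hfarP : ∀ x ∈ tsupport P, r₁ ≤ ‖x‖) (hP : ∀ y, mirrorZ (P (mirrorZ y)) = -P y)
    {c : ℝ} (hU0 : U₁ 0 = c • e₃) (hΔ : 0 ≤ -(ν * ⟪U₁ 0, (Δ U₁) 0⟫)) :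
    ¬ 0 < ⟪(U₁ + P) 0, accel ν (U₁ + P) 0⟫ := fun hpos => by
  have hP0 : P 0 = 0 := image_eq_zero_of_notMem_tsupport fun h0 => by
    have := hfarP 0 h0
    rw [norm_zero] at this
    linarith
  have hd : Disjoint (tsupport U₁) (tsupport P) :=
    disjoint_left.2 fun x hx₁ hx₂ => (not_le.2 (mem_ball_zero_iff.1 (hsupp hx₁))) (hfarP x hx₂)
  have hfar : ∀ x ∈ tsupport P, r₁ / 2 < ‖(0 : EuclideanSpace ℝ (Fin 3)) - x‖ := fun x hx => by
    rw [zero_sub, norm_neg]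
    linarith [hfarP x hx]
  have h0 : ∫ x, fderiv ℝ (fun w => fderiv ℝ (fun w' => fderiv ℝ newtonKernel w' (P x)) w (P x))
      ((0 : EuclideanSpace ℝ (Fin 3)) - x) (U₁ 0) = 0 := by
    rw [hU0]
    exact integral_anchorIntegrand_eq_zero_of_mirror_odd P hP hP0 c
  have h1 := (anchor_test_iff_fderiv3 (ν := ν) h₁ h₁c hdiv₁ he h₂ h₂c hdiv₂ hd (by linarith : (0 : ℝ) < r₁ / 2)
    hfar).1 hpos
  linarith

/-- **The blob of record plus ANY mirror-odd far pusher is NOT level-0 data** (`0 < a ≤ 2`; `P ∈ C_c^∞` divergence free,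
mirror-odd, `tsupport P ⊆ {‖x‖ ≥ 9/2}`; every radius `ρ`, every rates record `R`). [cite: MajdaBertozziCUP2002, §1.8 Prop. 1.16] -/
theorem not_levelZeroDataAt_tinyProfileAt_add_of_mirror_odd (R : TowerRates) {a : ℝ} (ha : 0 < a) (ha2 : a ≤ 2)
    {P : EuclideanSpace ℝ (Fin 3) → EuclideanSpace ℝ (Fin 3)} (h₂ : ContDiff ℝ ∞ P) (h₂c : HasCompactSupport P)
    (hdiv₂ : VectorCalculus.IsDivFree P) (hfarP : ∀ x ∈ tsupport P, (9 / 2 : ℝ) ≤ ‖x‖)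
    (hP : ∀ y, mirrorZ (P (mirrorZ y)) = -P y) (ρ : ℝ) :
    ¬ LevelZeroDataAt R (tinyProfileAt R a + P) ρ := fun hL => by
  obtain ⟨heven, -, hflat⟩ := tinyProfileAt_even_flat R a
  have hsupp : tsupport (tinyProfileAt R a) ⊆ ball (0 : EuclideanSpace ℝ (Fin 3)) (9 / 2) := fun x hx => by
    have h := tsupport_tinyProfileAt_subset (R := R) ha hx
    rw [mem_closedBall, dist_zero_right] at h
    rw [mem_ball, dist_zero_right]
    linarith
  have hΔ : 0 ≤ -(1 * ⟪tinyProfileAt R a 0, (Δ (tinyProfileAt R a)) 0⟫) := by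
    rw [hflat, inner_zero_right, mul_zero, neg_zero]
  have hP0 : P 0 = 0 := image_eq_zero_of_notMem_tsupport fun h0 => by
    have := hfarP 0 h0
    rw [norm_zero] at this
    linarith
  refine not_strictAnchor_add_of_mirror_odd (ν := 1) (contDiff_tinyProfileAt R a)
    (hasCompactSupport_tinyProfileAt ha) (isDivFree_tinyProfileAt ha.ne') heven (by norm_num : (0 : ℝ) < 9 / 2) hsupp
    h₂ h₂c hdiv₂ hfarP hP (tinyProfileAt_zero R a).1 hΔ (hL.anchor 0 ?_)
  rw [Pi.add_apply, hP0, add_zero]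
  exact (tinyProfileAt_zero R a).2

/-! ## §3 Generic (anti)symmetrisation and the instance: the antisymmetric ring pair -/

/-- For ANY field `A`, the symmetrised device `A + A♭` is mirror-invariant. [folklore] -/
theorem mirror_invariant_add_mirrorConj (A : EuclideanSpace ℝ (Fin 3) → EuclideanSpace ℝ (Fin 3))
    (y : EuclideanSpace ℝ (Fin 3)) :
    mirrorZ ((A + fun z => mirrorZ (A (mirrorZ z))) (mirrorZ y)) = (A + fun z => mirrorZ (A (mirrorZ z))) y := by
  simp only [Pi.add_apply, mirrorZ_mirrorZ, map_add]
  rw [add_comm]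

/-- For ANY field `A`, the antisymmetrised device `A − A♭` is mirror-odd. [folklore] -/
theorem mirror_odd_sub_mirrorConj (A : EuclideanSpace ℝ (Fin 3) → EuclideanSpace ℝ (Fin 3))
    (y : EuclideanSpace ℝ (Fin 3)) :
    mirrorZ ((A - fun z => mirrorZ (A (mirrorZ z))) (mirrorZ y)) = -(A - fun z => mirrorZ (A (mirrorZ z))) y := by
  simp only [Pi.sub_apply, mirrorZ_mirrorZ, map_sub]
  abel

/-- Mirror-oddness is preserved by scalar multiples. [folklore] -/
theorem mirror_odd_smul {P : EuclideanSpace ℝ (Fin 3) → EuclideanSpace ℝ (Fin 3)}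
    (hP : ∀ y, mirrorZ (P (mirrorZ y)) = -P y) (μ : ℝ) (y : EuclideanSpace ℝ (Fin 3)) :
    mirrorZ ((μ • P) (mirrorZ y)) = -(μ • P) y := by
  simp only [Pi.smul_apply, map_smul, hP y, smul_neg]

/-- The antisymmetric ring pair `μ • (P_δ − P♭_δ)` is mirror-odd. [folklore] -/
theorem mirror_odd_smul_ringAntiPair (μ δ : ℝ) (y : EuclideanSpace ℝ (Fin 3)) :
    mirrorZ ((μ • (ringPusher δ - mirrorRingPusher δ)) (mirrorZ y)) = -(μ • (ringPusher δ - mirrorRingPusher δ)) y := by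
  refine mirror_odd_smul (fun z => ?_) μ y
  simp only [Pi.sub_apply, mirrorRingPusher, mirrorZ_mirrorZ, map_sub]
  abel

/-- The antisymmetric ring pair vanishes on `‖x‖ < 9/2`. [folklore] -/
theorem smul_ringAntiPair_eq_zero_of_norm_lt {δ : ℝ} (hδ : 0 < δ) (hδ4 : δ ≤ 1 / 4) (μ : ℝ)
    {x : EuclideanSpace ℝ (Fin 3)} (hx : ‖x‖ < 9 / 2) : (μ • (ringPusher δ - mirrorRingPusher δ)) x = 0 := by
  rw [Pi.smul_apply, Pi.sub_apply, ringPusher_eq_zero_of_norm_lt hδ hδ4 hx, mirrorRingPusher_eq_zero_of_norm_lt hδ hδ4 hx,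
    sub_zero, smul_zero]

/-- On the support of the antisymmetric ring pair, `‖x‖ ≥ 9/2`. [folklore] -/
theorem norm_ge_of_mem_tsupport_smul_ringAntiPair {δ : ℝ} (hδ : 0 < δ) (hδ4 : δ ≤ 1 / 4) (μ : ℝ)
    {x : EuclideanSpace ℝ (Fin 3)} (hx : x ∈ tsupport (μ • (ringPusher δ - mirrorRingPusher δ))) : (9 / 2 : ℝ) ≤ ‖x‖ := by
  have hcl : IsClosed {y : EuclideanSpace ℝ (Fin 3) | (9 / 2 : ℝ) ≤ ‖y‖} := isClosed_le continuous_const continuous_norm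
  refine (closure_minimal (fun y hy => ?_) hcl) hx
  by_contra hlt
  exact hy (smul_ringAntiPair_eq_zero_of_norm_lt hδ hδ4 μ (not_le.1 hlt))

/-- The antisymmetric ring pair is smooth. [folklore] -/
theorem contDiff_smul_ringAntiPair (μ δ : ℝ) : ContDiff ℝ ∞ (μ • (ringPusher δ - mirrorRingPusher δ)) :=
  ((contDiff_ringPusher δ).sub (contDiff_mirrorRingPusher δ)).const_smul μ

/-- The antisymmetric ring pair has compact support (`0 < δ ≤ 1/4`). [folklore] -/
theorem hasCompactSupport_smul_ringAntiPair {δ : ℝ} (hδ : 0 < δ) (hδ4 : δ ≤ 1 / 4) (μ : ℝ) :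
    HasCompactSupport (μ • (ringPusher δ - mirrorRingPusher δ)) :=
  ((hasCompactSupport_ringPusher hδ hδ4).sub (hasCompactSupport_mirrorRingPusher hδ hδ4)).comp_left
    (g := fun v : EuclideanSpace ℝ (Fin 3) => μ • v) (smul_zero μ)

/-- The ring anti-pair is divergence free (the divergence is additive). [folklore] -/
theorem isDivFree_ringAntiPair (δ : ℝ) : VectorCalculus.IsDivFree (ringPusher δ - mirrorRingPusher δ) := fun x => by
  show VectorCalculus.divergence (fun y => ringPusher δ y - mirrorRingPusher δ y) x = 0
  rw [divergence_sub_apply (((contDiff_ringPusher δ).differentiable (by simp)) x)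
    (((contDiff_mirrorRingPusher δ).differentiable (by simp)) x), isDivFree_ringPusher δ x,
    isDivFree_mirrorRingPusher δ x, sub_zero]

/-- The antisymmetric ring pair is divergence free. [folklore] -/
theorem isDivFree_smul_ringAntiPair (μ δ : ℝ) : VectorCalculus.IsDivFree (μ • (ringPusher δ - mirrorRingPusher δ)) :=
  VectorCalculus.IsDivFree.const_smul
    (((contDiff_ringPusher δ).sub (contDiff_mirrorRingPusher δ)).differentiable (by simp)) (isDivFree_ringAntiPair δ) μ

/-- Rotations about the axis are linear: `R_θ (μ (a − b)) = μ (R_θ a − R_θ b)`. [folklore] -/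
theorem rotZ_smul_sub (θ μ : ℝ) (a b : EuclideanSpace ℝ (Fin 3)) :
    rotZ θ (μ • (a - b)) = μ • (rotZ θ a - rotZ θ b) := by
  ext i; fin_cases i <;> simp <;> ring

/-- The antisymmetric ring pair is sterile: axisymmetric and swirl-free. [folklore] -/
theorem isAxisymmetric_hasNoSwirl_smul_ringAntiPair (μ δ : ℝ) :
    IsAxisymmetric (μ • (ringPusher δ - mirrorRingPusher δ)) ∧ HasNoSwirl (μ • (ringPusher δ - mirrorRingPusher δ)) := by
  refine ⟨fun θ x => ?_, fun x => ?_⟩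
  · simp only [Pi.smul_apply, Pi.sub_apply, isAxisymmetric_ringPusher δ θ x, isAxisymmetric_mirrorRingPusher δ θ x,
      rotZ_smul_sub]
  · have h1 := hasNoSwirl_ringPusher δ x
    have h2 := hasNoSwirl_mirrorRingPusher δ x
    simp only [swirl] at h1 h2 ⊢
    simp only [Pi.smul_apply, Pi.sub_apply, PiLp.smul_apply, PiLp.sub_apply, smul_eq_mul]
    linear_combination μ * h1 - μ * h2

/-- **THE ANTISYMMETRIC RING PAIR NEVER FILLS LEVEL 0 WITH THE BLOB OF RECORD**: for `0 < a ≤ 2`, `0 < δ ≤ 1/4`, EVERY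
amplitude `μ` and every radius `ρ`, `¬ LevelZeroDataAt R (tinyProfileAt R a + μ • (ringPusher δ − mirrorRingPusher δ)) ρ`.
[cite: MajdaBertozziCUP2002, §1.8 Prop. 1.16] -/
theorem not_levelZeroDataAt_tinyProfileAt_add_smul_ringAntiPair (R : TowerRates) {a : ℝ} (ha : 0 < a) (ha2 : a ≤ 2)
    {δ : ℝ} (hδ : 0 < δ) (hδ4 : δ ≤ 1 / 4) (μ ρ : ℝ) :
    ¬ LevelZeroDataAt R (tinyProfileAt R a + μ • (ringPusher δ - mirrorRingPusher δ)) ρ :=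
  not_levelZeroDataAt_tinyProfileAt_add_of_mirror_odd R ha ha2 (contDiff_smul_ringAntiPair μ δ)
    (hasCompactSupport_smul_ringAntiPair hδ hδ4 μ) (isDivFree_smul_ringAntiPair μ δ)
    (fun _ hx => norm_ge_of_mem_tsupport_smul_ringAntiPair hδ hδ4 μ hx) (mirror_odd_smul_ringAntiPair μ δ) ρ

/-- **Level 0 is blind to the device's sign**: for `0 < a ≤ 2` and any admissible far device `P` (`tsupport P ⊆ {‖x‖ ≥ 9/2}`),
the blob of record plus `−P` passes the strict anchor at `0` iff the blob plus `P` does. [cite: MajdaBertozziCUP2002, §1.8 Prop. 1.16] -/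
theorem strictAnchor_tinyProfileAt_add_neg_iff (R : TowerRates) {a : ℝ} (ha : 0 < a) (ha2 : a ≤ 2) (ν : ℝ)
    {P : EuclideanSpace ℝ (Fin 3) → EuclideanSpace ℝ (Fin 3)} (h₂ : ContDiff ℝ ∞ P) (h₂c : HasCompactSupport P)
    (hdiv₂ : VectorCalculus.IsDivFree P) (hfarP : ∀ x ∈ tsupport P, (9 / 2 : ℝ) ≤ ‖x‖) :
    0 < ⟪(tinyProfileAt R a + -P) 0, accel ν (tinyProfileAt R a + -P) 0⟫ ↔
      0 < ⟪(tinyProfileAt R a + P) 0, accel ν (tinyProfileAt R a + P) 0⟫ := by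
  obtain ⟨heven, -, -⟩ := tinyProfileAt_even_flat R a
  have hsupp : tsupport (tinyProfileAt R a) ⊆ ball (0 : EuclideanSpace ℝ (Fin 3)) (9 / 2) := fun x hx => by
    have h := tsupport_tinyProfileAt_subset (R := R) ha hx
    rw [mem_closedBall, dist_zero_right] at h
    rw [mem_ball, dist_zero_right]
    linarith
  exact strictAnchor_add_neg_iff (ν := ν) (contDiff_tinyProfileAt R a) (hasCompactSupport_tinyProfileAt ha)
    (isDivFree_tinyProfileAt ha.ne') heven (by norm_num : (0 : ℝ) < 9 / 2) hsupp h₂ h₂c hdiv₂ hfarP (tinyProfileAt_zero R a).1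

end Summit.NavierStokesRegularity.EpisodeBaseTMirrorOddPusherNoAnchor

end
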